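import Literature.Probability.LatticeModels.ObservableLimitHolomorphic
import HarnessLib

/-!
# Discrete Cauchy ⇒ continuum Cauchy for a CR lattice function, two edge types renormalised separately

Topic `Literature/Probability/LatticeModels` (analytic glue for lattice scaling limits, continuing
`DiscreteCauchyRiemann.lean`, `ScalingLimitRiemannSums.lean`, `ObservableLimitHolomorphic.lean`).
Smirnov 2010, §5 (proof of Theorem 2.2): "the limit … satisfies, by Remark 3.3, the discrete
Cauchy–Riemann relations in the limit; by Morera's theorem it is analytic".
`ObservableLimitHolomorphic.lean` runs this Morera step for the FK-Ising observable, whose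
vertical edge values are within `O(δ√δ)` of the horizontal ones (s-holomorphicity). This file
proves the general statement behind it, for ANY discretely Cauchy–Riemann lattice function
`F k : MedialVertex → ℂ` (`CRVertex`/`CRFace` at the sites of a compact) whose horizontal and
vertical edge values, renormalised by the same constants, converge SEPARATELY: if the step
functions `u₀ k → g₀` (horizontal edges) and `u₁ k → g₁` (vertical edges) uniformly on a compact
neighbourhood of a rectangle, then `∮ (g₀ + g₁) dz = 0` around it
(`wedgeIntegral_add_eq_zero_of_cr_twoTypes`). The discrete contour sum `boundary_sum_eq_zero_of_cr`
vanishes identically and its four sides are Riemann sums of BOTH edge types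
(`tendsto_mul_sum_of_tendstoUniformlyOn`). Only the SUM `g₀ + g₁` is constrained: the discrete
Cauchy–Riemann system couples the two edge types through differences only, so `g₀ - g₁` is
anti-holomorphic in general (e.g. `+1` on horizontal and `-1` on vertical edges is exactly CR).

Also: the lift `typedEdgeFun Gf` of a two-type site function `Gf : Site 2 → Fin 2 → ℂ` (value
`Gf x i` at the edge `s(x, x + e_i)`) to a function on medial vertices, with its `CRVertex` /
`CRFace` dictionary (`crVertex_typedEdgeFun`, `crFace_typedEdgeFun`) — the form in which route
`CriticalPhenomena/CardyFormulaZ2/CardyDualCurrent` states the Cauchy–Riemann relations of a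
local parafermionic template (`LocalParafermionicTemplate.IsExactCRIn`). Everything is proved;
`[folklore]` apart from the Morera step itself.

## References

* S. Smirnov, *Conformal invariance in random cluster models. I*, Ann. of Math. 172 (2010)
  1435–1467, Remark 3.3 and §5 — bib key `Smirnov2010`.
-/

noncomputable section

namespace Literature.Probability.LatticeModels

open Filter _root_.Topology Metric Set Complex

/-! ### A two-type site function as a function on medial vertices -/

/-- The medial vertices `s(x, x + e_i)` and `s(y, y + e_j)` coincide only for `(x, i) = (y, j)`.
[folklore] -/
theorem mk_add_single_eq_iff {x y : Site 2} {i j : Fin 2} :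
    (s(x, x + Pi.single i 1) : MedialVertex) = s(y, y + Pi.single j 1) ↔ x = y ∧ i = j := by
  constructor
  · intro h
    rw [Sym2.eq_iff] at h
    rcases h with ⟨h1, h2⟩ | ⟨h1, h2⟩
    · subst h1
      refine ⟨rfl, ?_⟩
      have h3 : (Pi.single i (1 : ℤ) : Site 2) = Pi.single j 1 := add_left_cancel h2
      by_contra hij
      have := congrFun h3 i
      simp [hij] at this
    · exfalso
      have h3 : (Pi.single j (1 : ℤ) : Site 2) + Pi.single i 1 = 0 := by
        have : y + (Pi.single j 1 + Pi.single i 1) = y + 0 := by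
          rw [add_zero, ← add_assoc, ← h1]; exact h2
        exact add_left_cancel this
      have := congrFun h3 i
      by_cases hij : j = i
      · subst hij; simp at this
      · simp [Ne.symm hij] at this
  · rintro ⟨rfl, rfl⟩
    rfl

open scoped Classical in
/-- The function on medial vertices whose value at the edge `s(x, x + e_i)` is `Gf x i`
(junk `0` off the lattice edges of the two positive types). [folklore] -/
def typedEdgeFun (Gf : Site 2 → Fin 2 → ℂ) : MedialVertex → ℂ := fun e =>
  if h : ∃ p : Site 2 × Fin 2, e = s(p.1, p.1 + Pi.single p.2 1) then Gf h.choose.1 h.choose.2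
  else 0

open scoped Classical in
/-- `typedEdgeFun Gf` at `s(x, x + e_i)` is `Gf x i`. [folklore] -/
theorem typedEdgeFun_mk (Gf : Site 2 → Fin 2 → ℂ) (x : Site 2) (i : Fin 2) :
    typedEdgeFun Gf s(x, x + Pi.single i 1) = Gf x i := by
  unfold typedEdgeFun
  have h : ∃ p : Site 2 × Fin 2, (s(x, x + Pi.single i 1) : MedialVertex) =
      s(p.1, p.1 + Pi.single p.2 1) := ⟨(x, i), rfl⟩
  rw [dif_pos h]
  obtain ⟨h1, h2⟩ := mk_add_single_eq_iff.1 h.choose_spec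
  rw [← h1, ← h2]

/-- Horizontal edge values of `typedEdgeFun`. [folklore] -/
theorem typedEdgeFun_cSrc_zero (Gf : Site 2 → Fin 2 → ℂ) (x : Site 2) :
    typedEdgeFun Gf (cSrc (x, 0)) = Gf x 0 :=
  typedEdgeFun_mk Gf x 0

/-- Vertical edge values of `typedEdgeFun`. [folklore] -/
theorem typedEdgeFun_cSrc_one (Gf : Site 2 → Fin 2 → ℂ) (x : Site 2) :
    typedEdgeFun Gf (cSrc (x, 1)) = Gf x 1 :=
  typedEdgeFun_mk Gf x 1

/-- The template's vertex relation at `v` is `CRVertex` for the lifted function. [folklore] -/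
theorem crVertex_typedEdgeFun {Gf : Site 2 → Fin 2 → ℂ} {v : Site 2}
    (h : Gf v 1 - Gf (v - Pi.single 1 1) 1 = I * (Gf v 0 - Gf (v - Pi.single 0 1) 0)) :
    CRVertex (typedEdgeFun Gf) v := by
  rw [crVertex_iff]
  simp only [edgeFun, typedEdgeFun_cSrc_zero, typedEdgeFun_cSrc_one]
  exact h

/-- The template's face relation at `f` is `CRFace` for the lifted function. [folklore] -/
theorem crFace_typedEdgeFun {Gf : Site 2 → Fin 2 → ℂ} {f : Site 2}
    (h : Gf (f + Pi.single 1 1) 0 - Gf f 0 = I * (Gf (f + Pi.single 0 1) 1 - Gf f 1)) :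
    CRFace (typedEdgeFun Gf) f := by
  rw [crFace_iff]
  simp only [edgeFun, typedEdgeFun_cSrc_zero, typedEdgeFun_cSrc_one]
  exact h

/-! ### The discrete contour sum of a CR lattice function and its limit (two edge types) -/

/-- **Discrete Cauchy ⇒ continuum Cauchy, for the two edge types separately renormalised.**
Along meshes `s k → 0`, let `F k` be lattice functions (on medial vertices) that are discretely
Cauchy–Riemann at every site whose mesh point lies in the compact `K`, and let the step
functions `u₀ k`, `u₁ k` carry their renormalised horizontal / vertical edge values
(`c k · F k (s(x, x+e₀)) = s k · u₀ k (δx)`, `c k · F k (s(x, x+e₁)) = s k · u₁ k (δx)`). If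
`u₀ k → g₀` and `u₁ k → g₁` uniformly on `K ⊇ (Rectangle z w)_r`, `g₀, g₁` continuous on `K`,
then `∮_{∂R} (g₀ + g₁) dz = 0` in the form `wedgeIntegral z w (g₀+g₁) + wedgeIntegral w z (g₀+g₁) = 0`
(ordered corners). The discrete contour sum `boundary_sum_eq_zero_of_cr` vanishes identically;
its four sides are Riemann sums of both edge types (`tendsto_mul_sum_of_tendstoUniformlyOn`).
(Smirnov 2010, Remark 3.3 and §5, Morera step; here for a general CR lattice function.)
[cite: Smirnov2010, §5 (proof of Theorem 2.2, Morera step)] -/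
theorem wedgeIntegral_add_eq_zero_of_cr_twoTypes {s : ℕ → ℝ} (hs0 : ∀ k, 0 < s k)
    (hs : Tendsto s atTop (𝓝 0)) {g₀ g₁ : ℂ → ℂ} {z w : ℂ} (hre : z.re ≤ w.re) (him : z.im ≤ w.im)
    {K : Set ℂ} (hK : IsCompact K) (hg₀ : ContinuousOn g₀ K) (hg₁ : ContinuousOn g₁ K)
    {r : ℝ} (hr : 0 < r) (hKR : cthickening r (Rectangle z w) ⊆ K)
    (F : ℕ → MedialVertex → ℂ) (c : ℕ → ℂ) (u₀ u₁ : ℕ → ℂ → ℂ)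
    (hu₀ : ∀ k (x : Site 2), c k * F k (cSrc (x, 0)) = (s k : ℂ) * u₀ k (meshPoint (s k) x))
    (hu₁ : ∀ k (x : Site 2), c k * F k (cSrc (x, 1)) = (s k : ℂ) * u₁ k (meshPoint (s k) x))
    (hconv₀ : TendstoUniformlyOn u₀ g₀ atTop K) (hconv₁ : TendstoUniformlyOn u₁ g₁ atTop K)
    (hsr : ∀ k, 3 * s k ≤ r)
    (hcr : ∀ k (x : Site 2), meshPoint (s k) x ∈ K → CRVertex (F k) x ∧ CRFace (F k) x) :
    wedgeIntegral z w (fun ζ => g₀ ζ + g₁ ζ) + wedgeIntegral w z (fun ζ => g₀ ζ + g₁ ζ) = 0 := by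
  -- notation
  set b : ℕ → Site 2 := fun k => nearestSite (s k) z with hb
  set m : ℕ → ℕ := fun k => ⌊(w.re - z.re) / s k⌋₊ with hm
  set n : ℕ → ℕ := fun k => ⌊(w.im - z.im) / s k⌋₊ with hn
  set ℓx := w.re - z.re with hℓx
  set ℓy := w.im - z.im with hℓy
  have hℓx0 : 0 ≤ ℓx := by rw [hℓx]; linarith
  have hℓy0 : 0 ≤ ℓy := by rw [hℓy]; linarith
  have hfloorx : ∀ k, (m k : ℝ) * s k ≤ ℓx ∧ ℓx < (m k + 1) * s k := fun k =>
    floor_mul_le_of_le hℓx0 (hs0 k)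
  have hfloory : ∀ k, (n k : ℝ) * s k ≤ ℓy ∧ ℓy < (n k + 1) * s k := fun k =>
    floor_mul_le_of_le hℓy0 (hs0 k)
  -- (a) grid points are in `K`
  have hgridK : ∀ k (i j : ℤ), -1 ≤ i → i ≤ m k + 1 → -1 ≤ j → j ≤ n k + 1 →
      meshPoint (s k) (vtx (b k) i j) ∈ K := by
    intro k i j hi hi' hj hj'
    have h3 := meshPoint_vtx_mem_cthickening (hs0 k) z w hre him hi hi' hj hj'
    exact hKR (cthickening_mono (hsr k) _ h3)
  -- (b) the discrete contour sum vanishes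
  have hBS : ∀ k,
      ∑ i ∈ Finset.range (m k + 1), (vmid (F k) (b k) i (n k) - vmid (F k) (b k) i (-1)) +
        ∑ i ∈ Finset.range (m k), (hmid (F k) (b k) i (n k) - hmid (F k) (b k) i 0) -
        I * (∑ j ∈ Finset.range (n k + 1), (hmid (F k) (b k) (m k) j - hmid (F k) (b k) (-1) j) +
          ∑ j ∈ Finset.range (n k), (vmid (F k) (b k) (m k) j - vmid (F k) (b k) 0 j)) = 0 := by
    intro k
    refine boundary_sum_eq_zero_of_cr (F k) (b k) (m k) (n k) (fun i j hi hj => ?_)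
      (fun i j hi hj => ?_)
    · exact (hcr k _ (hgridK k i j (by omega) (by omega) (by omega) (by omega))).1
    · exact (hcr k _ (hgridK k i j (by omega) (by omega) (by omega) (by omega))).2
  -- (c) the four side integrals, for each of `g₀`, `g₁`
  set Itop : (ℂ → ℂ) → ℂ := fun g => ∫ x : ℝ in z.re..w.re, g (x + w.im * I) with hItop
  set Ibot : (ℂ → ℂ) → ℂ := fun g => ∫ x : ℝ in z.re..w.re, g (x + z.im * I) with hIbot
  set Irig : (ℂ → ℂ) → ℂ := fun g => ∫ y : ℝ in z.im..w.im, g (w.re + y * I) with hIrig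
  set Ilef : (ℂ → ℂ) → ℂ := fun g => ∫ y : ℝ in z.im..w.im, g (z.re + y * I) with hIlef
  -- Riemann sums of `u` along rows/columns converge to the side integrals
  have hrow : ∀ (u : ℕ → ℂ → ℂ) (g : ℂ → ℂ), ContinuousOn g K → TendstoUniformlyOn u g atTop K →
      ∀ (N : ℕ → ℕ) (jr : ℕ → ℤ) (h : ℝ), h ∈ Icc z.im w.im →
      (∀ k, N k = m k ∨ N k = m k + 1) → (∀ k, -1 ≤ jr k ∧ jr k ≤ n k + 1) →
      (∀ k, |z.im + s k * jr k - h| ≤ s k) →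
      Tendsto (fun k => (s k : ℂ) * ∑ t ∈ Finset.range (N k), u k (meshPoint (s k) (vtx (b k) t (jr k))))
        atTop (𝓝 (∫ x : ℝ in z.re..w.re, g (x + h * I))) := by
    intro u g hg hconv N jr h hh hN hjr hjh
    have hNℓ : Tendsto (fun k => (N k : ℝ) * s k) atTop (𝓝 ℓx) := by
      have h1 : Tendsto (fun k => (m k : ℝ) * s k) atTop (𝓝 ℓx) := by
        refine tendsto_of_tendsto_of_tendsto_of_le_of_le (g := fun k => ℓx - s k) (h := fun k => ℓx)
          ?_ tendsto_const_nhds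
          (fun k => by have := (hfloorx k).2; simp only; nlinarith) (fun k => (hfloorx k).1)
        simpa using (tendsto_const_nhds (x := ℓx)).sub hs
      have h2 : Tendsto (fun k => ((m k : ℝ) + 1) * s k) atTop (𝓝 ℓx) := by
        have : Tendsto (fun k => (m k : ℝ) * s k + s k) atTop (𝓝 (ℓx + 0)) := h1.add hs
        rw [add_zero] at this
        exact this.congr fun k => by ring
      refine tendsto_of_tendsto_of_tendsto_of_le_of_le h1 h2 (fun k => ?_) (fun k => ?_)
      · rcases hN k with h' | h' <;> simp only [h'] <;> push_cast <;> nlinarith [hs0 k]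
      · rcases hN k with h' | h' <;> simp only [h'] <;> push_cast <;> nlinarith [hs0 k]
    have key := tendsto_mul_sum_of_tendstoUniformlyOn hK hg hconv hs0 hs hℓx0 hNℓ
      (p := (h : ℂ) * I) (v := 1) (by simp) (a₀ := z.re) (m₀ := r / 2) (by positivity)
      ((row_image_subset_cthickening z w hr hh hre).trans hKR) (C := 2) (by norm_num)
      (P := fun k t => meshPoint (s k) (vtx (b k) t (jr k))) (fun k t ht => ?_) (fun k t ht => ?_)
    · have e : (fun x : ℝ => g ((h : ℂ) * I + (x : ℂ) * 1)) = fun x : ℝ => g (x + h * I) := by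
        funext x; ring_nf
      rw [show z.re + ℓx = w.re by rw [hℓx]; ring, e] at key
      exact key
    · exact hgridK k t (jr k) (by omega) (by rcases hN k with h' | h' <;> omega) (hjr k).1 (hjr k).2
    · calc _ ≤ s k + |z.im + s k * jr k - h| := dist_meshPoint_vtx_row_le (hs0 k) z t (jr k) h
        _ ≤ s k + s k := by gcongr; exact hjh k
        _ = 2 * s k := by ring
  have hcol : ∀ (u : ℕ → ℂ → ℂ) (g : ℂ → ℂ), ContinuousOn g K → TendstoUniformlyOn u g atTop K →
      ∀ (N : ℕ → ℕ) (ic : ℕ → ℤ) (h : ℝ), h ∈ Icc z.re w.re →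
      (∀ k, N k = n k ∨ N k = n k + 1) → (∀ k, -1 ≤ ic k ∧ ic k ≤ m k + 1) →
      (∀ k, |z.re + s k * ic k - h| ≤ s k) →
      Tendsto (fun k => (s k : ℂ) * ∑ t ∈ Finset.range (N k), u k (meshPoint (s k) (vtx (b k) (ic k) t)))
        atTop (𝓝 (∫ y : ℝ in z.im..w.im, g (h + y * I))) := by
    intro u g hg hconv N ic h hh hN hic hih
    have hNℓ : Tendsto (fun k => (N k : ℝ) * s k) atTop (𝓝 ℓy) := by
      have h1 : Tendsto (fun k => (n k : ℝ) * s k) atTop (𝓝 ℓy) := by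
        refine tendsto_of_tendsto_of_tendsto_of_le_of_le (g := fun k => ℓy - s k) (h := fun k => ℓy)
          ?_ tendsto_const_nhds
          (fun k => by have := (hfloory k).2; simp only; nlinarith) (fun k => (hfloory k).1)
        simpa using (tendsto_const_nhds (x := ℓy)).sub hs
      have h2 : Tendsto (fun k => ((n k : ℝ) + 1) * s k) atTop (𝓝 ℓy) := by
        have : Tendsto (fun k => (n k : ℝ) * s k + s k) atTop (𝓝 (ℓy + 0)) := h1.add hs
        rw [add_zero] at this
        exact this.congr fun k => by ring
      refine tendsto_of_tendsto_of_tendsto_of_le_of_le h1 h2 (fun k => ?_) (fun k => ?_)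
      · rcases hN k with h' | h' <;> simp only [h'] <;> push_cast <;> nlinarith [hs0 k]
      · rcases hN k with h' | h' <;> simp only [h'] <;> push_cast <;> nlinarith [hs0 k]
    have key := tendsto_mul_sum_of_tendstoUniformlyOn hK hg hconv hs0 hs hℓy0 hNℓ (p := (h : ℂ))
      (v := I) (by simp) (a₀ := z.im) (m₀ := r / 2) (by positivity)
      ((col_image_subset_cthickening z w hr hh him).trans hKR) (C := 2) (by norm_num)
      (P := fun k t => meshPoint (s k) (vtx (b k) (ic k) t)) (fun k t ht => ?_) (fun k t ht => ?_)
    · rw [show z.im + ℓy = w.im by rw [hℓy]; ring] at key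
      exact key
    · exact hgridK k (ic k) t (hic k).1 (hic k).2 (by omega) (by rcases hN k with h' | h' <;> omega)
    · calc _ ≤ s k + |z.re + s k * ic k - h| := dist_meshPoint_vtx_col_le (hs0 k) z (ic k) t h
        _ ≤ s k + s k := by gcongr; exact hih k
        _ = 2 * s k := by ring
  -- renormalised sums in terms of `u₀`, `u₁`
  have hHsum : ∀ k (N : ℕ) (x : ℕ → Site 2),
      c k * ∑ t ∈ Finset.range N, F k (cSrc (x t, 0)) =
        (s k : ℂ) * ∑ t ∈ Finset.range N, u₀ k (meshPoint (s k) (x t)) := by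
    intro k N x
    rw [Finset.mul_sum, Finset.mul_sum]
    exact Finset.sum_congr rfl fun t _ => hu₀ k (x t)
  have hVsum : ∀ k (N : ℕ) (x : ℕ → Site 2),
      c k * ∑ t ∈ Finset.range N, F k (cSrc (x t, 1)) =
        (s k : ℂ) * ∑ t ∈ Finset.range N, u₁ k (meshPoint (s k) (x t)) := by
    intro k N x
    rw [Finset.mul_sum, Finset.mul_sum]
    exact Finset.sum_congr rfl fun t _ => hu₁ k (x t)
  -- bookkeeping of the row/column indices
  have hvmid : ∀ k (i j : ℤ), vmid (F k) (b k) i j = F k (cSrc (vtx (b k) i j, 1)) := fun _ _ _ => rfl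
  have hhmid : ∀ k (i j : ℤ), hmid (F k) (b k) i j = F k (cSrc (vtx (b k) i j, 0)) := fun _ _ _ => rfl
  have hjn : ∀ k, |z.im + s k * (n k : ℕ) - w.im| ≤ s k := by
    intro k; have h' := hfloory k
    rw [abs_le]; constructor <;> nlinarith [h'.1, h'.2]
  have hj0 : ∀ k, |z.im + s k * ((0 : ℕ) : ℤ) - z.im| ≤ s k := by intro k; simp [(hs0 k).le]
  have hjm1 : ∀ k, |z.im + s k * (-1 : ℤ) - z.im| ≤ s k := by intro k; simp [abs_of_pos (hs0 k)]
  have him_ : ∀ k, |z.re + s k * (m k : ℕ) - w.re| ≤ s k := by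
    intro k; have h' := hfloorx k
    rw [abs_le]; constructor <;> nlinarith [h'.1, h'.2]
  have hi0 : ∀ k, |z.re + s k * ((0 : ℕ) : ℤ) - z.re| ≤ s k := by intro k; simp [(hs0 k).le]
  have him1 : ∀ k, |z.re + s k * (-1 : ℤ) - z.re| ≤ s k := by intro k; simp [abs_of_pos (hs0 k)]
  have hzim : z.im ∈ Icc z.im w.im := ⟨le_rfl, him⟩
  have hwim : w.im ∈ Icc z.im w.im := ⟨him, le_rfl⟩
  have hzre : z.re ∈ Icc z.re w.re := ⟨le_rfl, hre⟩
  have hwre : w.re ∈ Icc z.re w.re := ⟨hre, le_rfl⟩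
  -- the eight limits
  -- A1: top row, vertical values (`g₁`)
  have LA1 : Tendsto (fun k => c k * ∑ i ∈ Finset.range (m k + 1), vmid (F k) (b k) i (n k)) atTop
      (𝓝 (Itop g₁)) := by
    have h := hrow u₁ g₁ hg₁ hconv₁ (fun k => m k + 1) (fun k => n k) w.im hwim (fun k => Or.inr rfl)
      (fun k => ⟨by omega, by omega⟩) hjn
    refine h.congr fun k => ?_
    simp_rw [hvmid]; exact (hVsum k (m k + 1) fun t => vtx (b k) t (n k)).symm
  -- A2: top row, horizontal values (`g₀`)
  have LA2 : Tendsto (fun k => c k * ∑ i ∈ Finset.range (m k), hmid (F k) (b k) i (n k)) atTop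
      (𝓝 (Itop g₀)) := by
    have h := hrow u₀ g₀ hg₀ hconv₀ m (fun k => n k) w.im hwim (fun k => Or.inl rfl)
      (fun k => ⟨by omega, by omega⟩) hjn
    refine h.congr fun k => ?_
    simp_rw [hhmid]; exact (hHsum k (m k) fun t => vtx (b k) t (n k)).symm
  -- B1: bottom row `j = -1`, vertical values
  have LB1 : Tendsto (fun k => c k * ∑ i ∈ Finset.range (m k + 1), vmid (F k) (b k) i (-1)) atTop
      (𝓝 (Ibot g₁)) := by
    have h := hrow u₁ g₁ hg₁ hconv₁ (fun k => m k + 1) (fun _ => -1) z.im hzim (fun k => Or.inr rfl)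
      (fun k => ⟨by omega, by omega⟩) hjm1
    refine h.congr fun k => ?_
    simp_rw [hvmid]; exact (hVsum k (m k + 1) fun t => vtx (b k) t (-1)).symm
  -- B2: bottom row `j = 0`, horizontal values
  have LB2 : Tendsto (fun k => c k * ∑ i ∈ Finset.range (m k), hmid (F k) (b k) i 0) atTop
      (𝓝 (Ibot g₀)) := by
    have h := hrow u₀ g₀ hg₀ hconv₀ m (fun _ => 0) z.im hzim (fun k => Or.inl rfl)
      (fun k => ⟨by omega, by omega⟩) (fun k => by simpa using hj0 k)
    refine h.congr fun k => ?_
    simp_rw [hhmid]; exact (hHsum k (m k) fun t => vtx (b k) t 0).symm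
  -- C1: right column `i = m`, horizontal values
  have LC1 : Tendsto (fun k => c k * ∑ j ∈ Finset.range (n k + 1), hmid (F k) (b k) (m k) j) atTop
      (𝓝 (Irig g₀)) := by
    have h := hcol u₀ g₀ hg₀ hconv₀ (fun k => n k + 1) (fun k => m k) w.re hwre (fun k => Or.inr rfl)
      (fun k => ⟨by omega, by omega⟩) him_
    refine h.congr fun k => ?_
    simp_rw [hhmid]; exact (hHsum k (n k + 1) fun t => vtx (b k) (m k) t).symm
  -- C2: right column, vertical values
  have LC2 : Tendsto (fun k => c k * ∑ j ∈ Finset.range (n k), vmid (F k) (b k) (m k) j) atTop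
      (𝓝 (Irig g₁)) := by
    have h := hcol u₁ g₁ hg₁ hconv₁ n (fun k => m k) w.re hwre (fun k => Or.inl rfl)
      (fun k => ⟨by omega, by omega⟩) him_
    refine h.congr fun k => ?_
    simp_rw [hvmid]; exact (hVsum k (n k) fun t => vtx (b k) (m k) t).symm
  -- D1: left column `i = -1`, horizontal values
  have LD1 : Tendsto (fun k => c k * ∑ j ∈ Finset.range (n k + 1), hmid (F k) (b k) (-1) j) atTop
      (𝓝 (Ilef g₀)) := by
    have h := hcol u₀ g₀ hg₀ hconv₀ (fun k => n k + 1) (fun _ => -1) z.re hzre (fun k => Or.inr rfl)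
      (fun k => ⟨by omega, by omega⟩) him1
    refine h.congr fun k => ?_
    simp_rw [hhmid]; exact (hHsum k (n k + 1) fun t => vtx (b k) (-1) t).symm
  -- D2: left column `i = 0`, vertical values
  have LD2 : Tendsto (fun k => c k * ∑ j ∈ Finset.range (n k), vmid (F k) (b k) 0 j) atTop
      (𝓝 (Ilef g₁)) := by
    have h := hcol u₁ g₁ hg₁ hconv₁ n (fun _ => 0) z.re hzre (fun k => Or.inl rfl)
      (fun k => ⟨by omega, by omega⟩) (fun k => by simpa using hi0 k)
    refine h.congr fun k => ?_
    simp_rw [hvmid]; exact (hVsum k (n k) fun t => vtx (b k) 0 t).symm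
  -- the renormalised contour sum and its limit
  have hT : Tendsto (fun k => (c k * ∑ i ∈ Finset.range (m k + 1), vmid (F k) (b k) i (n k) -
        c k * ∑ i ∈ Finset.range (m k + 1), vmid (F k) (b k) i (-1)) +
      (c k * ∑ i ∈ Finset.range (m k), hmid (F k) (b k) i (n k) -
        c k * ∑ i ∈ Finset.range (m k), hmid (F k) (b k) i 0) -
      I * ((c k * ∑ j ∈ Finset.range (n k + 1), hmid (F k) (b k) (m k) j -
          c k * ∑ j ∈ Finset.range (n k + 1), hmid (F k) (b k) (-1) j) +
        (c k * ∑ j ∈ Finset.range (n k), vmid (F k) (b k) (m k) j -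
          c k * ∑ j ∈ Finset.range (n k), vmid (F k) (b k) 0 j)))
      atTop (𝓝 ((Itop g₁ - Ibot g₁) + (Itop g₀ - Ibot g₀) -
        I * ((Irig g₀ - Ilef g₀) + (Irig g₁ - Ilef g₁)))) :=
    ((LA1.sub LB1).add (LA2.sub LB2)).sub (((LC1.sub LD1).add (LC2.sub LD2)).const_mul I)
  have hT0 : ∀ k, (c k * ∑ i ∈ Finset.range (m k + 1), vmid (F k) (b k) i (n k) -
        c k * ∑ i ∈ Finset.range (m k + 1), vmid (F k) (b k) i (-1)) +
      (c k * ∑ i ∈ Finset.range (m k), hmid (F k) (b k) i (n k) -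
        c k * ∑ i ∈ Finset.range (m k), hmid (F k) (b k) i 0) -
      I * ((c k * ∑ j ∈ Finset.range (n k + 1), hmid (F k) (b k) (m k) j -
          c k * ∑ j ∈ Finset.range (n k + 1), hmid (F k) (b k) (-1) j) +
        (c k * ∑ j ∈ Finset.range (n k), vmid (F k) (b k) (m k) j -
          c k * ∑ j ∈ Finset.range (n k), vmid (F k) (b k) 0 j)) = 0 := by
    intro k
    have h := congrArg (fun t => c k * t) (hBS k)
    simp only [mul_zero, Finset.sum_sub_distrib] at h
    rw [← h]; ring
  have hlim0 : (Itop g₁ - Ibot g₁) + (Itop g₀ - Ibot g₀) -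
      I * ((Irig g₀ - Ilef g₀) + (Irig g₁ - Ilef g₁)) = 0 := by
    refine tendsto_nhds_unique hT ?_
    exact tendsto_const_nhds.congr fun k => (hT0 k).symm
  -- integrability of the sides, to split the integrals of `g₀ + g₁`
  have hrect : Rectangle z w ⊆ K := (self_subset_cthickening _).trans hKR
  have hrowI : ∀ g : ℂ → ℂ, ContinuousOn g K → ∀ h ∈ Icc z.im w.im,
      IntervalIntegrable (fun x : ℝ => g (x + h * I)) MeasureTheory.volume z.re w.re := by
    intro g hg h hh
    refine (hg.comp (by fun_prop : Continuous fun x : ℝ => (x : ℂ) + h * I).continuousOn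
      fun x hx => hrect ?_).intervalIntegrable
    rw [Rectangle, mem_reProdIm]
    refine ⟨by simpa using hx, ?_⟩
    simp only [add_im, ofReal_im, mul_im, ofReal_re, I_im, mul_one, I_re, mul_zero, add_zero,
      zero_add]
    rw [uIcc_of_le him]; exact hh
  have hcolI : ∀ g : ℂ → ℂ, ContinuousOn g K → ∀ h ∈ Icc z.re w.re,
      IntervalIntegrable (fun y : ℝ => g (h + y * I)) MeasureTheory.volume z.im w.im := by
    intro g hg h hh
    refine (hg.comp (by fun_prop : Continuous fun y : ℝ => (h : ℂ) + y * I).continuousOn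
      fun y hy => hrect ?_).intervalIntegrable
    rw [Rectangle, mem_reProdIm]
    refine ⟨?_, by simpa using hy⟩
    simp only [add_re, ofReal_re, mul_re, I_re, mul_zero, ofReal_im, I_im, mul_one, sub_self,
      add_zero]
    rw [uIcc_of_le hre]; exact hh
  rw [Complex.wedgeIntegral_add_wedgeIntegral_eq]
  simp only [smul_eq_mul]
  rw [intervalIntegral.integral_add (hrowI g₀ hg₀ z.im hzim) (hrowI g₁ hg₁ z.im hzim),
    intervalIntegral.integral_add (hrowI g₀ hg₀ w.im hwim) (hrowI g₁ hg₁ w.im hwim),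
    intervalIntegral.integral_add (hcolI g₀ hg₀ w.re hwre) (hcolI g₁ hg₁ w.re hwre),
    intervalIntegral.integral_add (hcolI g₀ hg₀ z.re hzre) (hcolI g₁ hg₁ z.re hzre)]
  linear_combination (-1 : ℂ) * hlim0


end Literature.Probability.LatticeModels

end
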